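import Literature.NumberTheory.LFunctions.YoshidaWindowGramColumnData
import HarnessLib

/-!
# C∞ certificate pipeline — primitive validator K: the kernel tables `KB`, `KMT` from format-C records

The C∞ pipeline door (weil-10 `weilPositivityOn_of_cinf_pipeline`) consumes two claimed tables of the sector kernel
`Kb = Encl.sectorKernel odd (gramCoeff a)`: the square block `KB : (i, j) ↦ Kb i j` (`i, j < B`) and the coupling
columns in the transposed layout `KMT : (t, q) ↦ Kb q (B + t)` (`t < Nm`, `q < B`).  This file is the generic
PRODUCER of the packed enclosure facts `Encl.DataNear` for both layouts from the format-C special-value records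
(`Encl.TabValid` — the full table below `N`; `Encl.TabColValid` — the light column table on `[lo, up)`), by row
bands of `Encl.checkRect` (each band is one `decide` in a rung data module):

* `kBox` / `mem_kBox` — the box of a K-column entry: the full-table box `Encl.sectorBox` while the column mode is
  inside the full table, the light-column box `Encl.sectorColBox` beyond it;
* `kbDataNear_extendRows` — one checked row band of the square block;
* `kmtDataNear_extendRows` — one checked row band of the transposed coupling columns.

The bridge to the door's `CinfExact.TabNear` over `CinfPacked.ofPacked` is `CinfPacked.TabNear.of_dataNear`
(`WeilFormatCCinfCertPacked`), applied in the rung modules.  weil-2 gen17; supporting stmt-RiemannHypothesis-0098;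
standard axioms; no RH claim.
-/

set_option autoImplicit false
-- `Summit.RiemannHypothesis.RiemannHypothesis.…` is the layout-mandated namespace (summit = problem name).
set_option linter.dupNamespace false

namespace Summit.RiemannHypothesis.RiemannHypothesis.Theorems.WeilFormatC

open Literature.NumberTheory.LFunctions Literature.NumberTheory.LFunctions.Yoshida1992
open Literature.Analysis.ValidatedNumerics.NumericsMP

namespace CinfPrimK

variable {S : ℕ} {a : ℝ} {ks : List PrimeLen} {C : Encl.Consts} {tab ctab : List Encl.IdxRec} {N lo up : ℕ}

/-! ## The K-column box -/

/-- **Box of a K-column entry** `Kb i j` (`i` a block index, `j` a column mode index): the full-table box while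
`j + 1 < N` (both records in the full table), the light-column box beyond. -/
def kBox (odd : Bool) (S : ℕ) (C : Encl.Consts) (tab ctab : List Encl.IdxRec) (N i j : ℕ) : MI :=
  if j + 1 < N then Encl.sectorBox odd S C tab i j else Encl.sectorColBox odd S C tab ctab i j

/-- `kBox ∋ Kb i j` for `i + 1 < N`, `i < j`, `j + 1 < up` (full table valid below `N`, light table on `[lo, up)`
with `lo + 1 ≤ N`). -/
theorem mem_kBox (hS : 0 < S) (ha0 : 0 < a) (hks : PrimeData a ks) (hC : Encl.ConstsValid S a ks C)
    (hT : Encl.TabValid S a ks N tab) (hCT : Encl.TabColValid S a ks lo up ctab) (hlo : lo + 1 ≤ N) (odd : Bool)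
    {i j : ℕ} (hi : i + 1 < N) (hij : i < j) (hj : j + 1 < up) :
    MI.mem S (Encl.sectorKernel odd (gramCoeff a) i j) (kBox odd S C tab ctab N i j) := by
  unfold kBox
  split
  · next h => exact Encl.mem_sectorBox hS ha0 hks hC hT odd hi h
  · next h =>
    cases odd
    · simpa [Encl.sectorKernel, Encl.sectorColBox] using
        Encl.mem_evenColBox hS ha0 hks hC hT hCT (i := i) (m := j) (by omega) (by omega) (by omega) (by omega) hij
    · simpa [Encl.sectorKernel, Encl.sectorColBox] using
        Encl.mem_oddColBox hS ha0 hks hC hT hCT (k := i) (l := j) hi (by omega) hj hij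

/-! ## Row-band producers -/

/-- **Square block, one row band**: rows `[n, n + ki)` of `KB : (i, j) ↦ Kb i j` (`j < B`) checked against the
full-table boxes extend the packed enclosure from below `n` to below `n + ki` (`B + 1 ≤ N`). -/
theorem kbDataNear_extendRows (hS : 0 < S) (ha0 : 0 < a) (hks : PrimeData a ks) (hC : Encl.ConstsValid S a ks C)
    (hT : Encl.TabValid S a ks N tab) (odd : Bool) {B w o c ρ n ki : ℕ} {XP : List ℕ} (hBN : B + 1 ≤ N)
    (hn : n + ki ≤ B)
    (h1 : Encl.DataNear (fun i j ↦ Encl.sectorKernel odd (gramCoeff a) i j) n B w o c ρ XP)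
    (h : Encl.checkRect S c (ρ : ℤ) w B o (fun i j ↦ Encl.sectorBox odd S C tab i j) XP n ki 0 B = true) :
    Encl.DataNear (fun i j ↦ Encl.sectorKernel odd (gramCoeff a) i j) (n + ki) B w o c ρ XP :=
  Encl.DataNear.extendRows h1 fun i hi hik j hj ↦ by
    have h2 := Encl.near_of_checkRect hS (f := fun i j ↦ Encl.sectorKernel odd (gramCoeff a) i j)
      (fun i _ hik j _ hjk ↦ Encl.mem_sectorBox hS ha0 hks hC hT odd (by omega) (by simp at hjk; omega)) h hi hik
      (Nat.zero_le j) (by simpa using hj)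
    exact_mod_cast h2

/-- **Coupling columns (transposed layout), one row band**: rows `[n, n + ki)` of `KMT : (t, q) ↦ Kb q (B + t)`
(`q < B`) checked against `kBox` extend the packed enclosure (`B + 1 ≤ N`, `lo + 1 ≤ N`, and all column modes of
the band inside the light table: `B + (n + ki) + 1 ≤ up`). -/
theorem kmtDataNear_extendRows (hS : 0 < S) (ha0 : 0 < a) (hks : PrimeData a ks) (hC : Encl.ConstsValid S a ks C)
    (hT : Encl.TabValid S a ks N tab) (hCT : Encl.TabColValid S a ks lo up ctab) (hlo : lo + 1 ≤ N) (odd : Bool)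
    {B w o c ρ n ki : ℕ} {XP : List ℕ} (hBN : B + 1 ≤ N) (hup : B + (n + ki) + 1 ≤ up)
    (h1 : Encl.DataNear (fun t q ↦ Encl.sectorKernel odd (gramCoeff a) q (B + t)) n B w o c ρ XP)
    (h : Encl.checkRect S c (ρ : ℤ) w B o (fun t q ↦ kBox odd S C tab ctab N q (B + t)) XP n ki 0 B = true) :
    Encl.DataNear (fun t q ↦ Encl.sectorKernel odd (gramCoeff a) q (B + t)) (n + ki) B w o c ρ XP :=
  Encl.DataNear.extendRows h1 fun t ht htk q hq ↦ by
    have h2 := Encl.near_of_checkRect hS (f := fun t q ↦ Encl.sectorKernel odd (gramCoeff a) q (B + t))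
      (fun t _ htk q _ hqk ↦ mem_kBox hS ha0 hks hC hT hCT hlo odd (by simp at hqk; omega) (by simp at hqk; omega)
        (by omega)) h ht htk (Nat.zero_le q) (by simpa using hq)
    exact_mod_cast h2

/-! ## Starting rows -/

/-- No rows of the square block yet. -/
theorem kbDataNear_zero (odd : Bool) {B w o c ρ : ℕ} {XP : List ℕ} :
    Encl.DataNear (fun i j ↦ Encl.sectorKernel odd (gramCoeff a) i j) 0 B w o c ρ XP :=
  Encl.DataNear.zeroRows

/-- No rows of the coupling columns yet. -/
theorem kmtDataNear_zero (odd : Bool) {B w o c ρ : ℕ} {XP : List ℕ} :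
    Encl.DataNear (fun t q ↦ Encl.sectorKernel odd (gramCoeff a) q (B + t)) 0 B w o c ρ XP :=
  Encl.DataNear.zeroRows

end CinfPrimK

end Summit.RiemannHypothesis.RiemannHypothesis.Theorems.WeilFormatC
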